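import Summits.Ventures.PercRepro2.CaseOneThickeningT
import Summits.Ventures.PercRepro2.CaseOneRootsOnlyQ
import Summits.Ventures.PercRepro2.CaseOneRootsOnlyI
import Summits.Ventures.PercRepro2.CaseOneRootsAndOQ
import Summits.Ventures.PercRepro2.CaseOneRootsAndOI

/-!
# The root-class anchors of the six-form calculus (blind cell PercRepro2, p1 g30)

The D-world forms of the root-only class (`iiExprD_nonneg_of_rootsOnly`, `iExprD_nonneg_of_rootsOnly`)
and of the roots-and-`o` class (`iiExprD_nonneg_of_rootsAndO`, `iExprD_nonneg_of_rootsAndO`) hold at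
EVERY nonnegative threshold pair, and the one-line lemmas `iiExprT_nonneg_of_dworld` /
`iExprT_nonneg_of_dworld` turn them into the forms at every pair satisfying the odds condition
`c₁ · P(T′, o ∈ C₂) ≤ c₀ · P(T′)` — which the T-pair does (`odds_t`). Hence the T-world forms hold
on both classes and, with the four-form theorems, so do the six forms: **`closedAtT_of_rootsOnly`**
(every edge at the statement vertex joins a root, any multiplicities) and
**`closedAtT_of_rootsAndO`** (the roots and one edge to `o`), for every statement vertex `≠ a₁, o`
and every `b ≠ a₃`. Own code; standard axioms.
-/

namespace Summit.Ventures.PercRepro2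

namespace CaseOne

section RootAnchors
variable {V : Type*} {E : Type*} [Fintype E] [DecidableEq E] [Fintype V] [DecidableEq V]
  {R : Type*} [Field R] [LinearOrder R] [IsStrictOrderedRing R]
variable {ends : E → Sym2 V} {a₁ a₂ a₃ : V} {e₀ : E}

/-- **`(ii-T)` for the root-only class.** -/
theorem zSplitIIT_of_rootsOnly (p : E → R) (hp : IsProbVec p)
    (hroot : ∀ e, a₃ ∈ ends e → ends e = s(a₁, a₃) ∨ ends e = s(a₂, a₃)) (h1 : a₁ ≠ a₃)
    (o b : V) : ZSplitIIT p ends o a₁ a₂ a₃ b := by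
  unfold ZSplitIIT
  exact iiExprT_nonneg_of_dworld p hp ends o a₁ a₂ a₃ b _ _
    (iiExprD_nonneg_of_rootsOnly p hp hroot h1 o b _ _ (prob_nonneg hp _))
    (odds_t (ends := ends) (a₁ := a₁) (a₂ := a₂) (a₃ := a₃) p hp o)

/-- **`(i-T)` for the root-only class.** -/
theorem zSplitIT_of_rootsOnly (p : E → R) (hp : IsProbVec p)
    (hroot : ∀ e, a₃ ∈ ends e → ends e = s(a₁, a₃) ∨ ends e = s(a₂, a₃)) (h1 : a₁ ≠ a₃)
    (o : V) {b : V} (hb : b ≠ a₃) : ZSplitIT p ends o a₁ a₂ a₃ b := by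
  unfold ZSplitIT
  exact iExprT_nonneg_of_dworld p hp ends o a₁ a₂ a₃ b _ _
    (iExprD_nonneg_of_rootsOnly p hp hroot h1 o hb _ _ (prob_nonneg hp _))
    (odds_t (ends := ends) (a₁ := a₁) (a₂ := a₂) (a₃ := a₃) p hp o)

/-- **The root-only class is a `ClosedAtT` anchor**: every edge at the statement vertex joins a root. -/
theorem closedAtT_of_rootsOnly
    (hroot : ∀ e, a₃ ∈ ends e → ends e = s(a₁, a₃) ∨ ends e = s(a₂, a₃)) (h1 : a₁ ≠ a₃)
    (o : V) {b : V} (hb : b ≠ a₃) : ClosedAtT (R := R) o a₁ a₂ b E ends a₃ :=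
  fun p hp => ⟨zSplitII_of_rootsOnly p hp hroot h1 o b, zSplitIIQ_of_rootsOnly p hp hroot h1 o b,
    zSplitIIT_of_rootsOnly p hp hroot h1 o b, zSplitI_of_rootsOnly p hp hroot h1 o hb,
    zSplitIQ_of_rootsOnly p hp hroot h1 o hb, zSplitIT_of_rootsOnly p hp hroot h1 o hb⟩

/-- **`(ii-T)` for the roots-and-`o` class.** -/
theorem zSplitIIT_of_rootsAndO (p : E → R) (hp : IsProbVec p) {o : V} (he₀ : ends e₀ = s(o, a₃))
    (hroot : ∀ e, a₃ ∈ ends e → e ≠ e₀ → ends e = s(a₁, a₃) ∨ ends e = s(a₂, a₃)) (ho : o ≠ a₃)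
    (h1 : a₁ ≠ a₃) (b : V) : ZSplitIIT p ends o a₁ a₂ a₃ b := by
  unfold ZSplitIIT
  exact iiExprT_nonneg_of_dworld p hp ends o a₁ a₂ a₃ b _ _
    (iiExprD_nonneg_of_rootsAndO p hp he₀ hroot ho h1 b _ _ (prob_nonneg hp _) (prob_nonneg hp _))
    (odds_t (ends := ends) (a₁ := a₁) (a₂ := a₂) (a₃ := a₃) p hp o)

/-- **`(i-T)` for the roots-and-`o` class.** -/
theorem zSplitIT_of_rootsAndO (p : E → R) (hp : IsProbVec p) {o : V} (he₀ : ends e₀ = s(o, a₃))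
    (hroot : ∀ e, a₃ ∈ ends e → e ≠ e₀ → ends e = s(a₁, a₃) ∨ ends e = s(a₂, a₃)) (ho : o ≠ a₃)
    (h1 : a₁ ≠ a₃) {b : V} (hb : b ≠ a₃) : ZSplitIT p ends o a₁ a₂ a₃ b := by
  unfold ZSplitIT
  exact iExprT_nonneg_of_dworld p hp ends o a₁ a₂ a₃ b _ _
    (iExprD_nonneg_of_rootsAndO p hp he₀ hroot ho h1 hb _ _ (prob_nonneg hp _) (prob_nonneg hp _))
    (odds_t (ends := ends) (a₁ := a₁) (a₂ := a₂) (a₃ := a₃) p hp o)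

/-- **The roots-and-`o` class is a `ClosedAtT` anchor.** -/
theorem closedAtT_of_rootsAndO {o : V} (he₀ : ends e₀ = s(o, a₃))
    (hroot : ∀ e, a₃ ∈ ends e → e ≠ e₀ → ends e = s(a₁, a₃) ∨ ends e = s(a₂, a₃)) (ho : o ≠ a₃)
    (h1 : a₁ ≠ a₃) (h2 : a₂ ≠ a₃) {b : V} (hb : b ≠ a₃) : ClosedAtT (R := R) o a₁ a₂ b E ends a₃ :=
  fun p hp => ⟨zSplitII_of_rootsAndO p hp he₀ hroot ho h1 h2 hb,
    zSplitIIQ_of_rootsAndO p hp he₀ hroot ho h1 b, zSplitIIT_of_rootsAndO p hp he₀ hroot ho h1 b,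
    zSplitI_of_rootsAndO p hp he₀ hroot ho h1 hb, zSplitIQ_of_rootsAndO p hp he₀ hroot ho h1 hb,
    zSplitIT_of_rootsAndO p hp he₀ hroot ho h1 hb⟩

end RootAnchors

end CaseOne

end Summit.Ventures.PercRepro2
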